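import Summits.ResolutionOfSingularities.ResolutionOfSingularities.Theorems.WeightedInvariantIota3SigmaLevelLimit
import Summits.ResolutionOfSingularities.ResolutionOfSingularities.Theorems.WeightedInvariantIota3SigmaLevelLimitTie
import Summits.ResolutionOfSingularities.ResolutionOfSingularities.Theorems.WeightedInvariantIota3FormalFibreResidueField
import Summits.ResolutionOfSingularities.ResolutionOfSingularities.Theorems.WeightedInvariantIota3SigmaPresentationLE3
import Summits.ResolutionOfSingularities.ResolutionOfSingularities.Theorems.WeightedInvariantIota3TauStrat
import Summits.ResolutionOfSingularities.ResolutionOfSingularities.Theorems.WeightedInvariantJOpenPresentationIsolatedPoint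
import HarnessLib

/-!
# [OURS · L1 W4.3 · (o70-a) (F-1)] The LE3 ASSEMBLY of (EX-4): the uniform σ-level bound at every dimension-3, `ε ≠ 1`
# point-centre position from the level-μ dominance word — `levelBoundLE3_of_dominance`, `sigmaMaximiserExistsLE3_of_dominance`

Cell res-hironaka, LADDER-RESOLUTION rung L, slot W4.3, DOOR `Theses.WeightedInvariant.LocalEngine` (stmt-ResolutionOfSingularities-19897),
h8 point bodies / (o70-a); seat res-D-pv-036 g11 on res-L1-w43-plan-1 WORD 2026-08-27T21:44:20Z «(F-1)», continuing res-D-pv-038 g10's (EX-4)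
chain (recipe STATUS 21:35:10Z, handoff `D/res-D-pv-038/NOTES-g10.md` §Census «What is missing (2)»). `--supports stmt-ResolutionOfSingularities-19897
--as helper`. Replaces the role of NO printed item; NOT a statement of the manuscript [claim: Hironaka2017, status: under-review]. AI work, weaker than
expert review. Pure commutative algebra; definition-free; the dominance word is a HYPOTHESIS spelled out in the signature.

WHAT.
* `RatContact.levelBound_tie_of_dominanceAtLevel` — the TIE twin of `RatContact.levelBound_isolated_of_dominanceAtLevel` (p569336 §4): at a tie
  position (`Iota3.IsTiePosition S f`) of an excellent regular local ring of dimension `3`, `0 ≠ f ∈ 𝔪²` not of monomial type, the level-μ dominance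
  word (SPEC (Δ12) rev 4 l.224 `Iota3.TwoFlagDominanceAtLevelAt f`, spelled out) gives the uniform σ-level bound in lex-maximal-triple form — by
  res-D-pv-038's `levelBound_tie_of_dominance` (p572253) at the attained maximal ratio `a/b` (`exists_flagReaches_ratio_max`), its formal-fibre input
  `hcl` DISCHARGED by `FormalFibre.pRadicallyClosed_residueField_adicCompletion` (p573717), and the `b`-scaling of a lex-maximal reached triple.
* **`levelBoundLE3_of_dominance (p) (hDom)`** — at every LE3 point-centre position (`k₀` perfect of characteristic `p`, `S` regular local essentially of
  finite type over `k₀`, `dim S = 3`, `0 ≠ f ∈ 𝔪²`, top `(ν;ε;τ)`-stratum `= {𝔪}`, `ε ≠ 1`) the `hlev` hypothesis of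
  `Iota3.sigmaMaximiserExistsLE3_of_levelBound` (p566163) HOLDS, given the dominance word `TwoFlagDominanceAtLevelLE3Body p` (SPEC (Δ12) rev 4 l.263,
  spelled out as `hDom`; owner res-D-brk-1): the τ-dichotomy `iotaTau_eq_zero_or_eq_one` — `τ = 0` (then `ε = 0` by `iotaEps_eq_zero_or_eq_one`):
  ISOLATED, `IsolatedPoint.strat_iotaOrd_maximalIdeal` + `levelBound_isolated_of_dominanceAtLevel`; `τ = 1`: TIE by `iotaTau_eq_one_iff_isTiePosition`
  + `levelBound_tie_of_dominanceAtLevel`.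
* **`sigmaMaximiserExistsLE3_of_dominance (p) (hDom)`** — (o70-a) `SigmaMaximiserExistsLE3Body p` (spelled out) from the dominance word alone.

References (index only): Matsumura, *Commutative Ring Theory*, §32 (G-rings, formal fibres); Hironaka 2005 Rem. 7.1 (2). [cite: Matsumura1987, §32]
[cite: Hironaka2005, Rem. 7.1 (2)] [folklore]
-/

noncomputable section

open IsLocalRing Literature.AlgebraicGeometry.Resolution
open Summit.ResolutionOfSingularities.ResolutionOfSingularities.Theorems
open Summit.ResolutionOfSingularities.ResolutionOfSingularities.Theorems.ContactCylinder

set_option linter.dupNamespace false -- mandated namespace of this single-conjunct summit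

namespace Summit.ResolutionOfSingularities.ResolutionOfSingularities.Cruxes.HypersurfaceCentreConstruction.LocalEngine

namespace Iota3

namespace RatContact

/-! ## §1 The tie twin of `levelBound_isolated_of_dominanceAtLevel` -/

section Tie

variable {S : Type} [CommRing S] [IsRegularLocalRing S]

/-- **(EX-4) AT A TIE `ν`-POSITION from (DOM_μ), lex-maximal-triple form.** `S` excellent regular local of dimension `3`, `0 ≠ f ∈ 𝔪²` not
of monomial type, `(S, f)` a TIE position; `hdom` = SPEC (Δ12) rev 4 `TwoFlagDominanceAtLevelAt f` verbatim. Then there is `L` with `r₁ ≤ L·q`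
for every two-flag carrying `f` to level `r₁ν` of a lex-maximal reached admissible triple `(q ; r₁, r₂)`. (The maximal ratio `a/b` is attained,
`exists_flagReaches_ratio_max`; res-D-pv-038's `levelBound_tie_of_dominance` at that ratio with its formal-fibre clause discharged by
`FormalFibre.pRadicallyClosed_residueField_adicCompletion`; a lex-maximal reached triple has ratio `a/b` and scales by `b` to `(bq ; r₂a, r₂b)`.)
[OURS · L1 W4.3 · (EX-4) tie] [cite: Matsumura1987, §32] [folklore] -/
theorem levelBound_tie_of_dominanceAtLevel (hS : IsExcellentRing S) (hdim : ringKrullDim S = 3) {f : S} (hf0 : f ≠ 0)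
    (hf2 : f ∈ maximalIdeal S ^ 2) (hnm : ¬ IsMonomialType f) (htie : IsTiePosition S f)
    (hdom : ∀ (a b : ℕ), 0 < b →
      (∀ q' r₁' r₂' : ℕ, AdmissibleTriple q' r₁' r₂' → FlagReaches f (adicOrder f).toNat q' r₁' r₂' → r₁' * b ≤ a * r₂') →
      ∀ (g₁ g₂ g₁' g₂' : S) (q r₁ r₂ : ℕ), AdmissibleTriple q r₁ r₂ → r₁ * b = a * r₂ → IsTwoFlag g₁ g₂ → IsTwoFlag g₁' g₂' →
        f ∈ flagContactFiltration g₁ g₂ q r₁ r₂ (r₁ * (adicOrder f).toNat) →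
        f ∈ flagContactFiltration g₁' g₂' q r₁ r₂ (r₁ * (adicOrder f).toNat) →
        g₁' ∈ flagContactFiltration g₁ g₂ q r₁ r₂ r₁ ∧ g₂' ∈ flagContactFiltration g₁ g₂ q r₁ r₂ r₂) :
    ∃ L : ℕ, ∀ (g₁ g₂ : S) (q r₁ r₂ : ℕ), AdmissibleTriple q r₁ r₂ → IsTwoFlag g₁ g₂ →
      f ∈ flagContactFiltration g₁ g₂ q r₁ r₂ (r₁ * (adicOrder f).toNat) →
      (∀ q' r₁' r₂' : ℕ, AdmissibleTriple q' r₁' r₂' → FlagReaches f (adicOrder f).toNat q' r₁' r₂' → r₁' * r₂ ≤ r₁ * r₂') →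
      r₁ ≤ L * q := by
  -- the order `ν`
  have hfin : adicOrder f ≠ ⊤ := fun h => hf0 ((adicOrder_eq_top_iff f).mp h)
  have hνeq : adicOrder f = ((adicOrder f).toNat : ℕ∞) := (ENat.coe_toNat hfin).symm
  have hν : iotaOrd S f = ((adicOrder f).toNat : ℕ) := by
    refine (iotaOrd_eq_natCast_iff S f _).mpr ⟨(le_adicOrder_iff f _).mp hνeq.ge, fun h => ?_⟩
    have h' := Nat.cast_le.mp (((le_adicOrder_iff f _).mpr h).trans hνeq.le)
    omega
  have hG : IsGRing S := hS.isQuasiExcellentRing.isGRing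
  -- the maximal ratio `a/b` (attained) and res-D-pv-038's tie theorem at that ratio
  obtain ⟨ga, gb, a, b, hadm, hflab, hmemab, hbound⟩ := exists_flagReaches_ratio_max hS hdim hf0 hf2 hnm
  obtain ⟨L, hL⟩ := levelBound_tie_of_dominance hG htie hν hadm.1 hadm.2.2 hbound
    (fun g₁ g₂ g₁' g₂' q t hq hqt hfl hfl' hmem hmem' =>
      hdom a b hadm.1 hbound g₁ g₂ g₁' g₂' q (t * a) (t * b) ⟨hq, hqt, Nat.mul_le_mul_left t hadm.2.2⟩ (by ring) hfl hfl'
        hmem hmem')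
    (fun P _ 𝔠 _ _ h𝔠 p _ => FormalFibre.pRadicallyClosed_residueField_adicCompletion hG P 𝔠 h𝔠 p)
  refine ⟨L * a, fun g₁ g₂ q r₁ r₂ hadm' hfl hmem hlex => ?_⟩
  -- a lex-maximal reached triple has ratio `a/b`
  have heq : r₁ * b = a * r₂ :=
    le_antisymm (hbound q r₁ r₂ hadm' ⟨g₁, g₂, hfl, hmem⟩) (hlex b a b hadm ⟨ga, gb, hflab, hmemab⟩)
  -- scale it by `b`: `(bq ; r₂a, r₂b)`
  have hmem' : f ∈ flagContactFiltration g₁ g₂ (b * q) (r₂ * a) (r₂ * b) (r₂ * a * (adicOrder f).toNat) := by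
    rw [← flagContactFiltration_scale g₁ g₂ hadm'.1 hadm.1 r₁ r₂ (r₁ * (adicOrder f).toNat)] at hmem
    have hbr₁ : r₂ * a = b * r₁ := by rw [mul_comm r₂ a, ← heq, mul_comm]
    rw [hbr₁, mul_comm r₂ b, mul_assoc]
    exact hmem
  have hr₂ : r₂ ≤ L * (b * q) :=
    hL g₁ g₂ (b * q) r₂ (Nat.mul_pos hadm.1 hadm'.1) (by rw [mul_comm b q]; exact Nat.mul_le_mul_right b hadm'.2.1) hfl hmem'
  refine Nat.le_of_mul_le_mul_right ?_ hadm.1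
  calc r₁ * b = a * r₂ := heq
    _ ≤ a * (L * (b * q)) := Nat.mul_le_mul_left a hr₂
    _ = L * a * q * b := by ring

end Tie

end RatContact

/-! ## §2 The LE3 assembly: `hlev` of `sigmaMaximiserExistsLE3_of_levelBound` from the dominance word -/

/-- **(EX-4) AT EVERY LE3 POINT-CENTRE POSITION from the level-μ dominance word** (`TwoFlagDominanceAtLevelLE3Body p`, SPEC (Δ12) rev 4 l.263,
spelled out as `hDom`): the conclusion is the `hlev` hypothesis of `Iota3.sigmaMaximiserExistsLE3_of_levelBound` VERBATIM. The τ-dichotomy: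
`τ = 0` ⇒ `ε = 0` (as `ε ≠ 1`) ⇒ isolated equimultiple point (`IsolatedPoint.strat_iotaOrd_maximalIdeal`) ⇒
`RatContact.levelBound_isolated_of_dominanceAtLevel`; `τ = 1` ⇒ tie position (`iotaTau_eq_one_iff_isTiePosition`) ⇒
`RatContact.levelBound_tie_of_dominanceAtLevel`. Excellence of `S` from `Stacks07QW_field_holds` + `IsExcellentRing.of_essFiniteType`.
[OURS · L1 W4.3 · (o70-a) (F-1)] [cite: Matsumura1987, §32] [folklore] -/
theorem levelBoundLE3_of_dominance (p : ℕ)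
    (hDom : ∀ (k₀ : Type) [Field k₀] [CharP k₀ p] [PerfectField k₀]
      (S : Type) [CommRing S] [Algebra k₀ S] [Algebra.EssFiniteType k₀ S] [IsRegularLocalRing S] (f : S),
      ringKrullDim S = (3 : ℕ) → f ≠ 0 → f ∈ (maximalIdeal S) ^ 2 →
      topStratumPrime iotaOrdEpsTau S f = maximalIdeal S → iotaEps S f ≠ 1 →
      ∀ (a b : ℕ), 0 < b →
        (∀ q' r₁' r₂' : ℕ, AdmissibleTriple q' r₁' r₂' → FlagReaches f (adicOrder f).toNat q' r₁' r₂' → r₁' * b ≤ a * r₂') →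
        ∀ (g₁ g₂ g₁' g₂' : S) (q r₁ r₂ : ℕ), AdmissibleTriple q r₁ r₂ → r₁ * b = a * r₂ →
          IsTwoFlag g₁ g₂ → IsTwoFlag g₁' g₂' →
          f ∈ flagContactFiltration g₁ g₂ q r₁ r₂ (r₁ * (adicOrder f).toNat) →
          f ∈ flagContactFiltration g₁' g₂' q r₁ r₂ (r₁ * (adicOrder f).toNat) →
          g₁' ∈ flagContactFiltration g₁ g₂ q r₁ r₂ r₁ ∧ g₂' ∈ flagContactFiltration g₁ g₂ q r₁ r₂ r₂) :
    ∀ (k₀ : Type) [Field k₀] [CharP k₀ p] [PerfectField k₀]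
      (S : Type) [CommRing S] [Algebra k₀ S] [Algebra.EssFiniteType k₀ S] [IsRegularLocalRing S] (f : S),
      ringKrullDim S = (3 : ℕ) → f ≠ 0 → f ∈ (maximalIdeal S) ^ 2 →
      topStratumPrime iotaOrdEpsTau S f = maximalIdeal S → iotaEps S f ≠ 1 →
      ∃ L : ℕ, ∀ (g₁ g₂ : S) (q r₁ r₂ : ℕ), AdmissibleTriple q r₁ r₂ → IsTwoFlag g₁ g₂ →
        f ∈ flagContactFiltration g₁ g₂ q r₁ r₂ (r₁ * (adicOrder f).toNat) →
        (∀ q' r₁' r₂' : ℕ, AdmissibleTriple q' r₁' r₂' → FlagReaches f (adicOrder f).toNat q' r₁' r₂' → r₁' * r₂ ≤ r₁ * r₂') →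
        r₁ ≤ L * q := by
  intro k₀ _ _ _ S _ _ _ _ f hdim hf0 hf2 htop hε
  have hk : IsExcellentRing k₀ := Stacks07QW_field_holds k₀ k₀ inferInstance
  have hS : IsExcellentRing S := hk.of_essFiniteType ‹_›
  have hf : f ∈ maximalIdeal S := Ideal.pow_le_self two_ne_zero hf2
  have hnm : ¬ IsMonomialType f := not_isMonomialType_of_topStratumPrime_eq_maximalIdeal hdim hf htop
  have hdim3 : ringKrullDim S = 3 := by rw [hdim]; norm_cast
  have hdom := hDom k₀ S f hdim hf0 hf2 htop hε
  rcases iotaTau_eq_zero_or_eq_one S f with hτ | hτ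
  · -- `τ = 0`: an ISOLATED equimultiple point (`ε = 0` since `ε ≠ 1`)
    have hε0 : iotaEps S f = 0 := (iotaEps_eq_zero_or_eq_one S f).resolve_right hε
    exact RatContact.levelBound_isolated_of_dominanceAtLevel hS hdim3 hf0 hf2 hnm
      (fun 𝔭 _ hf𝔭 => IsolatedPoint.strat_iotaOrd_maximalIdeal hf htop hε0 hτ 𝔭 hf𝔭) hdom
  · -- `τ = 1`: a TIE position
    have htie : IsTiePosition S f := (iotaTau_eq_one_iff_isTiePosition hdim3.le f).mp hτ
    exact RatContact.levelBound_tie_of_dominanceAtLevel hS hdim3 hf0 hf2 hnm htie hdom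

/-- **(o70-a) FROM THE DOMINANCE WORD: `SigmaMaximiserExistsLE3Body p`** (spelled out) — at every LE3 point-centre position a σ-MAXIMISER with
a PRIMITIVE triple exists, given `TwoFlagDominanceAtLevelLE3Body p` (spelled out as `hDom`): `sigmaMaximiserExistsLE3_of_levelBound` ∘
`levelBoundLE3_of_dominance`. [OURS · L1 W4.3 · (o70-a)] [folklore] -/
theorem sigmaMaximiserExistsLE3_of_dominance (p : ℕ)
    (hDom : ∀ (k₀ : Type) [Field k₀] [CharP k₀ p] [PerfectField k₀]
      (S : Type) [CommRing S] [Algebra k₀ S] [Algebra.EssFiniteType k₀ S] [IsRegularLocalRing S] (f : S),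
      ringKrullDim S = (3 : ℕ) → f ≠ 0 → f ∈ (maximalIdeal S) ^ 2 →
      topStratumPrime iotaOrdEpsTau S f = maximalIdeal S → iotaEps S f ≠ 1 →
      ∀ (a b : ℕ), 0 < b →
        (∀ q' r₁' r₂' : ℕ, AdmissibleTriple q' r₁' r₂' → FlagReaches f (adicOrder f).toNat q' r₁' r₂' → r₁' * b ≤ a * r₂') →
        ∀ (g₁ g₂ g₁' g₂' : S) (q r₁ r₂ : ℕ), AdmissibleTriple q r₁ r₂ → r₁ * b = a * r₂ →
          IsTwoFlag g₁ g₂ → IsTwoFlag g₁' g₂' →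
          f ∈ flagContactFiltration g₁ g₂ q r₁ r₂ (r₁ * (adicOrder f).toNat) →
          f ∈ flagContactFiltration g₁' g₂' q r₁ r₂ (r₁ * (adicOrder f).toNat) →
          g₁' ∈ flagContactFiltration g₁ g₂ q r₁ r₂ r₁ ∧ g₂' ∈ flagContactFiltration g₁ g₂ q r₁ r₂ r₂) :
    ∀ (k₀ : Type) [Field k₀] [CharP k₀ p] [PerfectField k₀]
      (S : Type) [CommRing S] [Algebra k₀ S] [Algebra.EssFiniteType k₀ S] [IsRegularLocalRing S] (f : S),
      ringKrullDim S = (3 : ℕ) → f ≠ 0 → f ∈ (maximalIdeal S) ^ 2 →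
      topStratumPrime iotaOrdEpsTau S f = maximalIdeal S → iotaEps S f ≠ 1 →
      ∃ (g₁ g₂ : S) (q r₁ r₂ : ℕ), IsSigmaMaximiser f (adicOrder f).toNat g₁ g₂ q r₁ r₂ ∧ IsPrimitiveTriple q r₁ r₂ :=
  sigmaMaximiserExistsLE3_of_levelBound p (levelBoundLE3_of_dominance p hDom)

end Iota3

end Summit.ResolutionOfSingularities.ResolutionOfSingularities.Cruxes.HypersurfaceCentreConstruction.LocalEngine

end
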